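import Summits.Ventures.PercRepro.SixFourResidueTwoPieces
import Summits.Ventures.PercRepro.SixFourResidueThreeTail
import Summits.Ventures.PercRepro.SixFourResidueFourPlaneLineHolds

/-!
# C-025 at `(6, 4)` on every finite matroid — unconditional (p3, gen 12)

`sixFourResidue_of_two_pieces` (`SixFourResidueTwoPieces.lean`) reduces the per-solid residue `SixFourResidue` —
hence C-025 at `(6, 4)` — to the two named pieces of record, `TwentyOnePrime` (Theorem 21′: `0 ≤ J₃(G)` for every
rank-`4` set `G` with `|G| ≥ 10` of a simple matroid) and `PlaneLineFourBig` (the plane-line branch at `t = 4` with a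
plane trace of `≥ 8` points).  p2's `twentyOnePrime_holds` (`SixFourResidueThreeTail.lean`) and p5's
`planeLineFourBig_holds` (`SixFourResidueFourPlaneLineHolds.lean`) discharge both, so the residue holds
(`sixFourResidue_holds`), `RLS M 6 4` holds on every finite matroid (`rls_six_four_holds`), and the statement of record
for `C-025 (6, 4)` follows in the set-builder spelling (`c025_six_four`):
`Φ(6, 4) · #{A ⊆ E : ρ(A) = 6, ρ(E ∖ A) = 4} ≤ #{A ⊆ E : 4 < ρ(A) < 6}` with `Φ(6, 4) = 6/5`.
-/

namespace PercRepro.SixFour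

open Finset ThmH PerFlat ThmN

/-- **The per-solid residue of record holds**: `SixFourResidue`, from Theorem 21′ and the plane-line branch. -/
theorem sixFourResidue_holds : SixFourResidue :=
  sixFourResidue_of_two_pieces twentyOnePrime_holds planeLineFourBig_holds

/-- **C-025 at `(6, 4)` on every finite matroid**: `RLS M 6 4`, i.e.
`(6/5) · #{A ⊆ E : ρ(A) = 6, ρ(E ∖ A) = 4} ≤ #{A ⊆ E : ρ(A) = 5}`. -/
theorem rls_six_four_holds {α : Type} (M : Matroid α) [M.Finite] : RLS M 6 4 :=
  rls_six_four_of_residue sixFourResidue_holds M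

/-- **C-025 at `(6, 4)` on every finite matroid, in the set-builder spelling of `C025`**:
`Φ(6, 4) · #{A ⊆ E : ρ(A) = 6, ρ(E ∖ A) = 4} ≤ #{A ⊆ E : 4 < ρ(A) < 6}`. -/
theorem c025_six_four {α : Type} (M : Matroid α) [M.Finite] :
    phiK 6 4 * ({A : Set α | A ⊆ M.E ∧ M.eRk A = ((6 : ℕ) : ℕ∞) ∧ M.eRk (M.E \ A) = ((4 : ℕ) : ℕ∞)}.ncard : ℚ) ≤
      ({A : Set α | A ⊆ M.E ∧ ((4 : ℕ) : ℕ∞) < M.eRk A ∧ M.eRk A < ((6 : ℕ) : ℕ∞)}.ncard : ℚ) :=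
  c025_six_four_of_residue sixFourResidue_holds M

end PercRepro.SixFour
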